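import Summits.NavierStokesRegularity.NavierStokesRegularity.Theorems.HardyPointSinkNoHardyTypeIAncientHardyLargeScale
import Literature.Analysis.FluidPDE.LocalTypeIScaling

/-!
# Route HardyPointSink — crux `NoHardyTypeIAncient` (stmt-NavierStokesRegularity-7980), line
# `registered`: the certificate `hardyPointSink_cert_dssTraceless` (Hardy ⇒ the λ-DSS enemy is
# traceless)

Summit-side proof file (stub `hardyPointSink_cert_dssTraceless` of the registered skeleton). The
statement is PDE-free measure theory. The crux says that no Hardy-bounded Type-I bounded ancient
mild Navier–Stokes solution exists; its named enemy is a backward `λ`-discretely self-similar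
blow-up. This certificate records what the Hardy bound `∫ |u(t)|² / |x − x₀| ≤ K` (a.e. `t < 0`)
does to such an enemy: if the witness `u` (given for `t < 0`) extends to a field `v` which is
`λ`-discretely self-similar about `(x₀, T)`, `T > 0`, i.e.
`v(T − s/λ^{2j}, x₀ + λ^{-j} y) = λ^j v(T − s, x₀ + y)` for all `j : ℕ`, `y`, `s > 0`, then the
`L²`-mass of `v` in every fixed ball `B(x₀, ρ)` tends to `0` along the DSS times
`t_j = T − (T − t₀)/λ^{2j} ↑ T` ("traceless blow-up").

Proof. (1) Pick one time `t₀ < 0` at which the Hardy bound holds. (2) For `g := u t₀` the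
scale-invariant mean `R⁻¹ ∫_{B(x₀,R)} |g|²` tends to `0` as `R → ∞`: on `B(x₀, R₀)` one has
`|g|² ≤ R₀ · |g|²/|x − x₀|`, on the shell `R₀ ≤ |x − x₀| < R` one has `|g|² ≤ R · |g|²/|x − x₀|`,
so `R⁻¹ ∫_{B(x₀,R)} |g|² ≤ R⁻¹ R₀ K + ∫_{|x − x₀| ≥ R₀} |g|²/|x − x₀|`, and the last term is the
tail of a finite integral (`tendsto_setLIntegral_compl_ball_zero_of_center`). (3) DSS covariance
with `s = T − t₀` and the substitution `y ↦ λ^j y` (`scaledL2_nsZoom`) turn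
`∫_{B(0,ρ)} |v(t_j, x₀ + y)|² dy` into `ρ · (λ^j ρ)⁻¹ ∫_{B(x₀, λ^j ρ)} |g|²`, which tends to `0` by
(2) since `λ^j ρ → ∞`.

## References

* D. Chae, J. Wolf, Arch. Ration. Mech. Anal. 225 (2017) (backward discretely self-similar
  solutions; the covariance law used here). Folklore measure theory otherwise.
-/

noncomputable section

set_option linter.dupNamespace false

open MeasureTheory Set Function Filter TopologicalSpace Metric
open scoped ENNReal NNReal Topology

namespace Summit.NavierStokesRegularity.NavierStokesRegularity.Theorems

open Literature.Analysis.FluidPDE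

/-- Elementary `ℝ≥0∞` inequality behind the pointwise bound `|g|² ≤ R · (|g|² / |x − x₀|)` on the
ball `|x − x₀| < R` (including the centre, where `a / 0 = ∞` or `a = 0`): if `b ≤ c`, `c ≠ 0`,
`b ≠ ∞` then `a ≤ c * (a / b)`. [folklore] -/
theorem ennreal_le_mul_div_of_le {a b c : ℝ≥0∞} (hbc : b ≤ c) (hc : c ≠ 0) (hb : b ≠ ∞) :
    a ≤ c * (a / b) := by
  rcases eq_or_ne b 0 with rfl | hb0
  · rcases eq_or_ne a 0 with rfl | ha0
    · exact zero_le
    · rw [ENNReal.div_zero ha0, ENNReal.mul_top hc]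
      exact le_top
  · calc a = a / b * b := (ENNReal.div_mul_cancel hb0 hb).symm
      _ ≤ a / b * c := by gcongr
      _ = c * (a / b) := mul_comm _ _

/-- Tails of a finite Lebesgue integral on `ℝ³` off the balls `B(x₀, n)` about an arbitrary centre
tend to zero (dominated convergence for the indicators of `B(x₀, n)ᶜ`; the centred version is
`tendsto_lintegral_compl_ball_zero`). [folklore] -/
theorem tendsto_setLIntegral_compl_ball_zero_of_center (x₀ : EuclideanSpace ℝ (Fin 3))
    {h : EuclideanSpace ℝ (Fin 3) → ℝ≥0∞} (hm : AEMeasurable h volume) (hfin : ∫⁻ y, h y ≠ ∞) :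
    Tendsto (fun n : ℕ => ∫⁻ y in (ball x₀ (n : ℝ))ᶜ, h y) atTop (𝓝 0) := by
  -- adapted from `tendsto_lintegral_compl_ball_zero` (centre `0`)
  have hpt : ∀ y : EuclideanSpace ℝ (Fin 3),
      Tendsto (fun n : ℕ => (ball x₀ (n : ℝ))ᶜ.indicator h y) atTop (𝓝 0) := by
    intro y
    have hev : ∀ᶠ n : ℕ in atTop, (ball x₀ (n : ℝ))ᶜ.indicator h y = 0 := by
      filter_upwards [tendsto_natCast_atTop_atTop.eventually_gt_atTop (dist y x₀)] with n hn
      apply indicator_of_notMem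
      rwa [mem_compl_iff, not_not, mem_ball]
    exact tendsto_const_nhds.congr' (hev.mono fun n hn => hn.symm)
  have key := tendsto_lintegral_of_dominated_convergence' (μ := volume)
    (F := fun n : ℕ => (ball x₀ (n : ℝ))ᶜ.indicator h) (f := fun _ => 0) h
    (fun n => hm.indicator measurableSet_ball.compl)
    (fun n => ae_of_all _ fun y => indicator_le_self _ _ y) hfin (ae_of_all _ hpt)
  simpa only [lintegral_indicator measurableSet_ball.compl, lintegral_zero] using key

/-- **One-scale consequence of a Hardy bound at large scales.** If `∫ |g|²/|x − x₀| < ∞` then the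
scale-invariant `L²` mean `R⁻¹ ∫_{B(x₀, R)} |g|²` tends to `0` along every sequence of radii
`R_j → ∞`: split `B(x₀, R_j)` into `B(x₀, R₀)` (where `|g|² ≤ R₀ |g|²/|x − x₀|`) and the shell
(where `|g|² ≤ R_j |g|²/|x − x₀|`), so that
`R_j⁻¹ ∫_{B(x₀,R_j)} |g|² ≤ R_j⁻¹ R₀ ∫ |g|²/|x − x₀| + ∫_{B(x₀,R₀)ᶜ} |g|²/|x − x₀|`. [folklore] -/
theorem tendsto_scaledL2_ball_of_hardy (g : EuclideanSpace ℝ (Fin 3) → EuclideanSpace ℝ (Fin 3))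
    (x₀ : EuclideanSpace ℝ (Fin 3)) (hg : AEStronglyMeasurable g volume)
    (hH : ∫⁻ x, ‖g x‖ₑ ^ 2 / ‖x - x₀‖ₑ ≠ ∞)
    {R : ℕ → ℝ} (hR : Tendsto R atTop atTop) :
    Tendsto (fun j => (ENNReal.ofReal (R j))⁻¹ * ∫⁻ x in ball x₀ (R j), ‖g x‖ₑ ^ 2)
      atTop (𝓝 0) := by
  set h : EuclideanSpace ℝ (Fin 3) → ℝ≥0∞ := fun x => ‖g x‖ₑ ^ 2 / ‖x - x₀‖ₑ with hh_def
  have hm : AEMeasurable h volume :=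
    (hg.enorm.pow_const 2).div (measurable_id.sub_const x₀).enorm.aemeasurable
  -- pointwise: `|g x|² ≤ r · h x` on `B(x₀, r)`
  have hpt : ∀ {r : ℝ} {x : EuclideanSpace ℝ (Fin 3)}, x ∈ ball x₀ r →
      ‖g x‖ₑ ^ 2 ≤ ENNReal.ofReal r * h x := by
    intro r x hx
    have hd : dist x x₀ < r := mem_ball.1 hx
    refine ennreal_le_mul_div_of_le ?_ (ENNReal.ofReal_pos.2 (dist_nonneg.trans_lt hd)).ne'
      enorm_ne_top
    rw [← ofReal_norm, ← dist_eq_norm]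
    exact ENNReal.ofReal_le_ofReal hd.le
  -- the two-piece estimate
  have key : ∀ {R₀ : ℝ} (r : ℝ), (ENNReal.ofReal r)⁻¹ * ∫⁻ x in ball x₀ r, ‖g x‖ₑ ^ 2 ≤
      (ENNReal.ofReal r)⁻¹ * (ENNReal.ofReal R₀ * ∫⁻ x, h x) + ∫⁻ x in (ball x₀ R₀)ᶜ, h x := by
    intro R₀ r
    have h1 : ∫⁻ x in ball x₀ R₀, ‖g x‖ₑ ^ 2 ≤ ENNReal.ofReal R₀ * ∫⁻ x, h x :=
      calc ∫⁻ x in ball x₀ R₀, ‖g x‖ₑ ^ 2 ≤ ∫⁻ x in ball x₀ R₀, ENNReal.ofReal R₀ * h x :=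
            setLIntegral_mono' measurableSet_ball fun x hx => hpt hx
        _ = ENNReal.ofReal R₀ * ∫⁻ x in ball x₀ R₀, h x :=
            lintegral_const_mul' _ _ ENNReal.ofReal_ne_top
        _ ≤ ENNReal.ofReal R₀ * ∫⁻ x, h x :=
            mul_le_mul_right (setLIntegral_le_lintegral _ _) _
    have h2 : ∫⁻ x in ball x₀ r ∩ (ball x₀ R₀)ᶜ, ‖g x‖ₑ ^ 2 ≤
        ENNReal.ofReal r * ∫⁻ x in (ball x₀ R₀)ᶜ, h x :=
      calc ∫⁻ x in ball x₀ r ∩ (ball x₀ R₀)ᶜ, ‖g x‖ₑ ^ 2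
          ≤ ∫⁻ x in ball x₀ r ∩ (ball x₀ R₀)ᶜ, ENNReal.ofReal r * h x :=
            setLIntegral_mono' (measurableSet_ball.inter measurableSet_ball.compl)
              fun x hx => hpt hx.1
        _ = ENNReal.ofReal r * ∫⁻ x in ball x₀ r ∩ (ball x₀ R₀)ᶜ, h x :=
            lintegral_const_mul' _ _ ENNReal.ofReal_ne_top
        _ ≤ ENNReal.ofReal r * ∫⁻ x in (ball x₀ R₀)ᶜ, h x :=
            mul_le_mul_right (lintegral_mono_set inter_subset_right) _
    have hsub : ball x₀ r ⊆ ball x₀ R₀ ∪ ball x₀ r ∩ (ball x₀ R₀)ᶜ := fun x hx => by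
      by_cases hx' : x ∈ ball x₀ R₀
      exacts [Or.inl hx', Or.inr ⟨hx, hx'⟩]
    calc (ENNReal.ofReal r)⁻¹ * ∫⁻ x in ball x₀ r, ‖g x‖ₑ ^ 2
        ≤ (ENNReal.ofReal r)⁻¹ * ((∫⁻ x in ball x₀ R₀, ‖g x‖ₑ ^ 2) +
            ∫⁻ x in ball x₀ r ∩ (ball x₀ R₀)ᶜ, ‖g x‖ₑ ^ 2) :=
          mul_le_mul_right ((lintegral_mono_set hsub).trans (lintegral_union_le _ _ _)) _
      _ ≤ (ENNReal.ofReal r)⁻¹ * ((ENNReal.ofReal R₀ * ∫⁻ x, h x) +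
            ENNReal.ofReal r * ∫⁻ x in (ball x₀ R₀)ᶜ, h x) := by
          gcongr
      _ = (ENNReal.ofReal r)⁻¹ * (ENNReal.ofReal R₀ * ∫⁻ x, h x) +
            (ENNReal.ofReal r)⁻¹ * ENNReal.ofReal r * ∫⁻ x in (ball x₀ R₀)ᶜ, h x := by
          rw [mul_add, mul_assoc]
      _ ≤ (ENNReal.ofReal r)⁻¹ * (ENNReal.ofReal R₀ * ∫⁻ x, h x) +
            1 * ∫⁻ x in (ball x₀ R₀)ᶜ, h x := by
          gcongr
          exact ENNReal.inv_mul_le_one _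
      _ = _ := by rw [one_mul]
  -- ε-argument
  rw [ENNReal.tendsto_nhds_zero]
  intro ε hε
  have hε2 : 0 < ε / 2 := ENNReal.half_pos hε.ne'
  obtain ⟨N, hN⟩ := ENNReal.tendsto_atTop_zero.1
    (tendsto_setLIntegral_compl_ball_zero_of_center x₀ hm hH) (ε / 2) hε2
  have h0 : Tendsto (fun j => (ENNReal.ofReal (R j))⁻¹ * (ENNReal.ofReal (N : ℝ) * ∫⁻ x, h x))
      atTop (𝓝 0) := by
    have h1 : Tendsto (fun j => ENNReal.ofReal (R j)) atTop (𝓝 ∞) :=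
      ENNReal.tendsto_ofReal_atTop.comp hR
    have h2 : Tendsto (fun j => (ENNReal.ofReal (R j))⁻¹) atTop (𝓝 0) := by
      rw [← ENNReal.inv_top]
      exact tendsto_inv_iff.2 h1
    have h3 := ENNReal.Tendsto.mul_const h2
      (Or.inr (ENNReal.mul_ne_top ENNReal.ofReal_ne_top hH) :
        (0 : ℝ≥0∞) ≠ 0 ∨ ENNReal.ofReal (N : ℝ) * ∫⁻ x, h x ≠ ∞)
    rwa [zero_mul] at h3
  filter_upwards [ENNReal.tendsto_nhds_zero.1 h0 (ε / 2) hε2] with j hj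
  calc (ENNReal.ofReal (R j))⁻¹ * ∫⁻ x in ball x₀ (R j), ‖g x‖ₑ ^ 2
      ≤ (ENNReal.ofReal (R j))⁻¹ * (ENNReal.ofReal (N : ℝ) * ∫⁻ x, h x) +
          ∫⁻ x in (ball x₀ (N : ℝ))ᶜ, h x := key (R j)
    _ ≤ ε / 2 + ε / 2 := add_le_add hj (hN N le_rfl)
    _ = ε := ENNReal.add_halves ε

/-- **Certificate `hardyPointSink_cert_dssTraceless` (Hardy ⇒ the λ-DSS enemy is traceless).**
Let `u` (given for `t < 0`) be measurable in space at each time and satisfy the Hardy bound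
`∫ |u(t, x)|² / |x − x₀| dx ≤ K` for a.e. `t < 0`, and let `v` agree with `u` for `t < 0` and be
`λ`-discretely self-similar about `(x₀, T)`, `T > 0`, `λ > 1`:
`v(T − s/λ^{2j}, x₀ + λ^{-j} y) = λ^j v(T − s, x₀ + y)` (`j : ℕ`, `y ∈ ℝ³`, `s > 0`). Then for
some `t₀ < 0` and every `ρ > 0`,
`∫_{B(0, ρ)} |v(T − (T − t₀)/λ^{2j}, x₀ + y)|² dy → 0` as `j → ∞`: the blow-up profile leaves
no `L²` trace in any fixed ball about `x₀`. (Pick `t₀` where the Hardy bound holds; by covariance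
and `scaledL2_nsZoom` the `j`-th integral is `ρ · (λ^j ρ)⁻¹ ∫_{B(x₀, λ^j ρ)} |u(t₀)|²`, which tends
to `0` by `tendsto_scaledL2_ball_of_hardy`.) [folklore] -/
theorem hardyPointSink_cert_dssTraceless :
    ∀ (u v : ℝ → EuclideanSpace ℝ (Fin 3) → EuclideanSpace ℝ (Fin 3)) (x₀ : EuclideanSpace ℝ (Fin 3)) (K : ℝ≥0) (T lam : ℝ), 0 < T → 1 < lam → (∀ t < 0, AEStronglyMeasurable (u t) volume) → (∀ᵐ t ∂(volume.restrict (Iio (0 : ℝ))), ∫⁻ x, ‖u t x‖ₑ ^ 2 / ‖x - x₀‖ₑ ≤ K) → (∀ t < 0, v t = u t) → (∀ (j : ℕ) (y : EuclideanSpace ℝ (Fin 3)) (s : ℝ), 0 < s → v (T - s / lam ^ (2 * j)) (x₀ + (lam ^ j)⁻¹ • y) = lam ^ j • v (T - s) (x₀ + y)) → ∃ t₀ : ℝ, t₀ < 0 ∧ ∀ ρ : ℝ, 0 < ρ → Tendsto (fun j : ℕ => ∫⁻ y in Metric.ball (0 : EuclideanSpace ℝ (Fin 3)) ρ, ‖v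 (T - (T - t₀) / lam ^ (2 * j)) (x₀ + y)‖ₑ ^ 2) atTop (𝓝 0) := by
  intro u v x₀ K T lam hT hlam hmeas hH hagree hcov
  -- (1) one time `t₀ < 0` at which the Hardy bound holds
  haveI : (ae (volume.restrict (Iio (0 : ℝ)))).NeBot := by
    rw [ae_neBot, Ne, Measure.restrict_eq_zero, Real.volume_Iio]
    exact ENNReal.top_ne_zero
  obtain ⟨t₀, ht₀K, ht₀⟩ := (hH.and (ae_restrict_mem measurableSet_Iio)).exists
  replace ht₀ : t₀ < 0 := ht₀
  refine ⟨t₀, ht₀, fun ρ hρ => ?_⟩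
  have hlam0 : 0 < lam := one_pos.trans hlam
  have hs : 0 < T - t₀ := by linarith
  have hfin : ∫⁻ x, ‖u t₀ x‖ₑ ^ 2 / ‖x - x₀‖ₑ ≠ ∞ := (ht₀K.trans_lt ENNReal.coe_lt_top).ne
  -- (2) the scale-invariant means along `R_j = λ^j ρ → ∞` vanish
  have hR : Tendsto (fun j : ℕ => lam ^ j * ρ) atTop atTop :=
    (tendsto_pow_atTop_atTop_of_one_lt hlam).atTop_mul_const hρ
  have hlim := tendsto_scaledL2_ball_of_hardy (u t₀) x₀ (hmeas t₀ ht₀) hfin hR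
  -- (3) covariance + change of variables
  have heq : ∀ j : ℕ, ∫⁻ y in ball (0 : EuclideanSpace ℝ (Fin 3)) ρ,
      ‖v (T - (T - t₀) / lam ^ (2 * j)) (x₀ + y)‖ₑ ^ 2 =
        ENNReal.ofReal ρ * ((ENNReal.ofReal (lam ^ j * ρ))⁻¹ *
          ∫⁻ x in ball x₀ (lam ^ j * ρ), ‖u t₀ x‖ₑ ^ 2) := by
    intro j
    have hc : 0 < lam ^ j := pow_pos hlam0 j
    have hpt : ∀ y : EuclideanSpace ℝ (Fin 3),
        v (T - (T - t₀) / lam ^ (2 * j)) (x₀ + y) = lam ^ j • u t₀ (x₀ + lam ^ j • y) := by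
      intro y
      have h := hcov j (lam ^ j • y) (T - t₀) hs
      rwa [smul_smul, inv_mul_cancel₀ hc.ne', one_smul, sub_sub_cancel, hagree t₀ ht₀] at h
    have h1 := scaledL2_nsZoom hc hρ x₀ 0 (u t₀)
    rw [smul_zero, add_zero] at h1
    simp_rw [hpt]
    rw [← h1, ← mul_assoc,
      ENNReal.mul_inv_cancel (ENNReal.ofReal_pos.2 hρ).ne' ENNReal.ofReal_ne_top, one_mul]
  have h2 := ENNReal.Tendsto.const_mul hlim (Or.inr ENNReal.ofReal_ne_top :
    (0 : ℝ≥0∞) ≠ 0 ∨ ENNReal.ofReal ρ ≠ ∞)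
  rw [mul_zero] at h2
  exact h2.congr fun j => (heq j).symm

end Summit.NavierStokesRegularity.NavierStokesRegularity.Theorems
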